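import Literature.NumberTheory.ComplexMultiplication.CMOrderGorenstein
import Literature.NumberTheory.ComplexMultiplication.CMOrderWeakEquivalence
import HarnessLib

/-!
# The trace dual on ideal classes and weak equivalence classes (Marseglia 2019, Cor. 4.4 / 4.5; §4): `[I] = [J] ⟺
# [Iᵗ] = [Jᵗ]`, `I ~ J ⟺ Iᵗ ~ Jᵗ`, `(Iᵗ:Iᵗ) = (I:I)`, `(LI)ᵗ = L⁻¹Iᵗ`; «an ideal is invertible iff weakly equivalent to
# its multiplicator ring» and «`W̄k(S) = {[S]}` iff `S` is Gorenstein» — in any degree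

Family `hodge`, lane `lit-hodgefound` (Track 2 foundations library; seat p15, row g25-#3 — sequel of g25-#1
`CMOrderGorenstein` (trace-dual calculus, Gorenstein over-orders) and g24-#5 `CMOrderWeakEquivalence` (Prop. 4.1 (b)⟺(c),
Cor. 4.5, Thm. 4.6 for any order)), topic `Literature/NumberTheory/ComplexMultiplication`.  THEOREMS ONLY: no definition,
no instance, no named fact (D-0026, net Literature debt `0`).

Carriers, BY NAME, as in `CMOrderGorenstein`: `𝔬 = endOrder (M_μ)` (`μ : Basis ι ℚ K`, ANY degree; §1 for every order
`𝔯 = endOrder ρ`), Mathlib's `FractionalIdeal 𝔬⁰ K` with the ideal quotient `/` and `spanSingleton`, the trace dual as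
the hypothesis `(↑T : Submodule 𝔬 K) = Submodule.traceDual ℤ ℚ ↑I`, over-orders as idempotents `M = MM ≠ 0`; the
class `[I] = [J]` of `ICM(R)` is «`I = xJ`, `x ∈ K^×`» (COR. 3.4) and weak equivalence is PROP. 4.1 (b)
`1 ∈ (I:J)(J:I)` — no quotient type is introduced.

## Source, VERBATIM

S. Marseglia, *Computing the ideal class monoid of an order*, J. Lond. Math. Soc. (2) 101 (2020) [Marseglia2019],
held `paper:arxiv-1805.09671`, §4 p. 8 (chunk p0008):

> By Proposition 4.1 (b) an ideal is invertible if and only if it is weakly equivalent to its multiplicator ring and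
> hence we have that `W̄k(S) = {[S]}` if and only if `S` is Gorenstein.
> **Corollary 4.4.** Let `I` and `J` be fractional ideals. Then `[I] = [J] ⟺ [Iᵗ] = [Jᵗ]` and
> `[I]_wk = [J]_wk ⟺ [Iᵗ]_wk = [Jᵗ]_wk`.  *Proof.* Note that `I = xJ` if only if `Iᵗ = (1/x)Jᵗ`, which gives the
> first equivalence. The second equivalence follows from the equality `(I:J)(J:I) = (Jᵗ:Iᵗ)(Iᵗ:Jᵗ)` and part (b) of
> Proposition 4.1.
> **Corollary 4.5.** Let `I` and `J` be two weakly equivalent fractional `R`-ideals, and let `S` be their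
> multiplicator ring. Then `I = (I:J)J`, and `(I:J)` is a fractional ideal invertible in `S`. In particular, `I ≃ J`
> if and only if `(I:J)` is a principal fractional `S`-ideal.

and §2 Lemma 2.3, p. 4: `(xI)ᵗ = (1/x)Iᵗ`, `(I:J) = (Jᵗ:Iᵗ)`.

## What is formalised

* §1 (ANY order `𝔯`): **`EndOrder.one_mem_div_div_self_mul_iff`** (`1 ∈ (I:S)(S:I) ⟺ I·(S:I) = S`, `S = (I:I)` — «an
  ideal is invertible iff weakly equivalent to its multiplicator ring»), `EndOrder.one_mem_div_mul_div_iff_mul_div_eq`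
  (the same against any over-order `M` over which `I` is a module), **COR. 4.5** as an iff
  `EndOrder.exists_eq_spanSingleton_mul_iff_of_one_mem` (`I = xJ ⟺ (I:J) = x(J:J)` for weakly equivalent `I`, `J`).
* §2 **«`W̄k(S) = {[S]}` iff `S` is Gorenstein»**: `forall_one_mem_div_mul_div_iff_forall_div_div_eq` (every `M`-ideal
  with multiplicator ring `M` is weakly equivalent to `M` iff `M` is reflexive — through `CMOrderGorenstein`'s
  PROP. 2.7 (a)⟺(b)).
* §3 `traceDual_div_traceDual_eq_div_self` (`(Iᵗ:Iᵗ) = (I:I)`: the dual stays in the stratum of `S`).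
* §4 **COR. 4.4**: `eq_spanSingleton_mul_iff_of_coe_eq_traceDual` («`I = xJ` iff `Iᵗ = (1/x)Jᵗ`»),
  **`exists_eq_spanSingleton_mul_iff_of_coe_eq_traceDual`** (`[I] = [J] ⟺ [Iᵗ] = [Jᵗ]`),
  `div_mul_div_eq_of_coe_eq_traceDual` («`(I:J)(J:I) = (Jᵗ:Iᵗ)(Iᵗ:Jᵗ)`»),
  **`one_mem_div_mul_div_iff_of_coe_eq_traceDual`** (`I ~ J ⟺ Iᵗ ~ Jᵗ`).
* §5 `coe_mul_eq_traceDual_mul_of_mul_eq_one` (`(LI)ᵗ = L′Iᵗ` for `LL′ = 𝔬`), `coe_mul_eq_traceDual_of_mul_eq_one`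
  (`Lᵗ = L′𝔬ᵗ`).

NOT formalised: the quotient types `ICM(R)`, `Wk(R)` and the induced involution on them; genera (Remark 4.3).

## References
* [Marseglia2019] S. Marseglia, *Computing the ideal class monoid of an order*, J. Lond. Math. Soc. (2) 101 (2020)
  984–1007, §4 Cor. 4.4, Cor. 4.5 and the remark after Def. 4.2, p. 8; §2 Lemma 2.3, p. 4.
  [cite: Marseglia2019, §4 Cor. 4.4, p. 8]
* [BuchmannLenstra1994] J. A. Buchmann, H. W. Lenstra, Jr., *Approximating rings of integers in number fields*,
  J. Théor. Nombres Bordeaux 6 (1994) 221–260, §2.3 and Prop. 2.7, pp. 228–230. [cite: BuchmannLenstra1994, §2 Prop. 2.7, p. 230]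
* [Shimura1973] G. Shimura, *Introduction to the Arithmetic Theory of Automorphic Functions* (1971), §4.4 proof of
  Prop. 4.11, p. 106 (the order of `𝔞*` is the order of `𝔞`). [cite: Shimura1973, §4.4 Prop. 4.11 (proof), p. 106]
-/

noncomputable section

open scoped nonZeroDivisors NumberField Pointwise
open NumberField Module FractionalIdeal
open Submodule (traceDual)

namespace Literature.NumberTheory.ComplexMultiplication

/-! ## §1 «An ideal is invertible if and only if it is weakly equivalent to its multiplicator ring» (any order `𝔯`) -/

namespace EndOrder

section AnyOrder

variable {K : Type} [Field K] [NumberField K]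
variable {ι : Type} [Fintype ι] [DecidableEq ι] {ρ : K →ₐ[ℚ] Matrix ι ι ℚ}
variable [IsFractionRing (endOrder ρ) K]

/-- **«an ideal is invertible if and only if it is weakly equivalent to its multiplicator ring»**: with `S = (I:I)`,
`1 ∈ (I:S)(S:I) ⟺ I·(S:I) = S`. (⟹ is COR. 4.5 `I·(S:I)… = S` from PROP. 4.1 (b)⇒(c); ⟸: `I ⊆ (I:S)`, so
`(I:S)(S:I) ⊇ I(S:I) = S ∋ 1`.) [cite: Marseglia2019, §4 (after Def. 4.2: «an ideal is invertible if and only if it is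
weakly equivalent to its multiplicator ring»), p. 8] -/
theorem one_mem_div_div_self_mul_iff {I : FractionalIdeal (endOrder ρ)⁰ K} (hI : I ≠ 0) :
    (1 : K) ∈ I / (I / I) * (I / I / I) ↔ I * (I / I / I) = I / I := by
  have hS0 : I / I ≠ 0 := div_self_ne_zero hI
  constructor
  · intro h1
    rw [mul_comm, div_mul_eq_of_one_mem hS0 hI (by rwa [mul_comm])]
  · intro h
    have hle : I ≤ I / (I / I) := (le_div_iff_mul_le hS0).2 (by rw [mul_comm, div_self_mul_self_eq hI])
    have h1 : (1 : K) ∈ I * (I / I / I) := by rw [h]; exact one_mem_div_self hI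
    exact mul_le_mul' hle le_rfl h1

variable [Nonempty ι]

/-- **The same relative to an over-order `M = MM ≠ 0` over which `I` is a module (`MI = I`): `I` is invertible in `M`
iff `I` is weakly equivalent to `M`, `1 ∈ (I:M)(M:I) ⟺ I·(M:I) = M`** (weakly equivalent ideals have the same
multiplicator ring, so `(I:I) = (M:M) = M`; conversely LEMMA 2.5). [cite: Marseglia2019, §4 Prop. 4.1 ((b)⇒(c)) and the
remark after Def. 4.2, p. 8] -/
theorem one_mem_div_mul_div_iff_mul_div_eq {M I : FractionalIdeal (endOrder ρ)⁰ K} (hMM : M * M = M) (hM0 : M ≠ 0)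
    (hI : I ≠ 0) (hMI : M * I = I) : (1 : K) ∈ I / M * (M / I) ↔ I * (M / I) = M := by
  constructor
  · intro h1
    have hS : I / I = M := by
      rw [div_self_eq_div_self_of_one_mem hI hM0 h1, div_self_eq_of_mul_self_eq_endOrder hM0 hMM]
    rw [← hS] at h1 ⊢
    exact (one_mem_div_div_self_mul_iff hI).1 h1
  · intro h
    have hS : I / I = M := div_self_eq_of_mul_eq_overorder hMM hM0 hMI h
    rw [← hS] at h ⊢
    exact (one_mem_div_div_self_mul_iff hI).2 h

omit [Nonempty ι] in
/-- **COROLLARY 4.5: for weakly equivalent `I`, `J` (common multiplicator ring `S = (J:J)`), `I ≃ J` if and only if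
`(I:J)` is a principal fractional `S`-ideal** — `I = xJ ⟺ (I:J) = xS` («`I = (I:J)J`»; conversely «`(I:J) = (xJ:J) =
x(J:J) = xS`», the tree's `div_spanSingleton_mul_eq`). [cite: Marseglia2019, §4 Cor. 4.5, p. 8] -/
theorem exists_eq_spanSingleton_mul_iff_of_one_mem {I J : FractionalIdeal (endOrder ρ)⁰ K} (hI : I ≠ 0) (hJ : J ≠ 0)
    (h1 : (1 : K) ∈ I / J * (J / I)) :
    (∃ x : K, x ≠ 0 ∧ I = spanSingleton (endOrder ρ)⁰ x * J) ↔
      ∃ x : K, x ≠ 0 ∧ I / J = spanSingleton (endOrder ρ)⁰ x * (J / J) := by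
  constructor
  · rintro ⟨x, hx, h⟩
    exact ⟨x, hx, by rw [h, div_spanSingleton_mul_eq hx hJ]⟩
  · rintro ⟨x, hx, h⟩
    refine ⟨x, hx, ?_⟩
    rw [← div_mul_eq_of_one_mem hI hJ h1, h, mul_assoc, div_self_mul_self_eq hJ]

end AnyOrder

end EndOrder

namespace CMTypeLattice

section TraceDualClasses

variable {K : Type} [Field K] [NumberField K]
variable {ι : Type} [Fintype ι] [DecidableEq ι] [Nonempty ι] (μ : Basis ι ℚ K)
variable [IsFractionRing (endOrder (Algebra.leftMulMatrix μ)) K]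

/-! ## §2 «`W̄k(S) = {[S]}` if and only if `S` is Gorenstein» -/

/-- **«By Proposition 4.1 (b) an ideal is invertible if and only if it is weakly equivalent to its multiplicator ring
and hence we have that `W̄k(S) = {[S]}` if and only if `S` is Gorenstein»** — for every over-order `M = MM ≠ 0` of
`𝔬`: every `M`-ideal with multiplicator ring `M` is weakly equivalent to `M` iff `M` is Gorenstein in the reflexive
sense `(M:(M:I)) = I` (PROP. 2.10 (a)⟺(b) of `CMOrderGorenstein`). [cite: Marseglia2019, §4 (after Def. 4.2), p. 8]
[cite: BuchmannLenstra1994, §2 Prop. 2.7 ((a)⟺(b)), p. 230] -/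
theorem forall_one_mem_div_mul_div_iff_forall_div_div_eq {M : FractionalIdeal (endOrder (Algebra.leftMulMatrix μ))⁰ K}
    (hMM : M * M = M) (hM0 : M ≠ 0) :
    (∀ I : FractionalIdeal (endOrder (Algebra.leftMulMatrix μ))⁰ K, I ≠ 0 → M * I = I → I / I = M →
        (1 : K) ∈ I / M * (M / I)) ↔
      ∀ I : FractionalIdeal (endOrder (Algebra.leftMulMatrix μ))⁰ K, I ≠ 0 → M * I = I → M / (M / I) = I := by
  rw [forall_div_div_eq_iff_forall_div_self_eq_iff_mul_div_eq μ hMM hM0]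
  refine forall_congr' fun I => forall_congr' fun hI => forall_congr' fun hMI => ?_
  rw [EndOrder.one_mem_div_mul_div_iff_mul_div_eq hMM hM0 hI hMI]
  exact ⟨fun h => ⟨h, fun h' => EndOrder.div_self_eq_of_mul_eq_overorder hMM hM0 hMI h'⟩, fun h => h.1⟩

/-! ## §3 The trace dual preserves the multiplicator ring: `(Iᵗ : Iᵗ) = (I : I)` -/

omit [Nonempty ι] in
/-- **`(Iᵗ : Iᵗ) = (I : I)`**: the trace dual has the same multiplicator ring (LEMMA 2.3 `(I:J) = (Jᵗ:Iᵗ)` at `J = I`;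
«the multiplicator ring of `Tᵗ` is `T`»), so `I ↦ Iᵗ` maps `ICM_S(R)` to itself and `W̄k(S)` to itself.
[cite: Marseglia2019, §2 Lemma 2.3 and §3 Prop. 3.7 (proof: «the multiplicator ring of `Tᵗ` is `T`»), pp. 4, 6]
[cite: Shimura1973, §4.4 Prop. 4.11 (proof: «so that 𝔬 = 𝔬′»), p. 106] -/
theorem traceDual_div_traceDual_eq_div_self {I T : FractionalIdeal (endOrder (Algebra.leftMulMatrix μ))⁰ K} (hI : I ≠ 0)
    (hT0 : T ≠ 0)
    (hT : (T : Submodule (endOrder (Algebra.leftMulMatrix μ)) K) =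
      traceDual ℤ ℚ (I : Submodule (endOrder (Algebra.leftMulMatrix μ)) K)) : T / T = I / I :=
  (div_eq_div_of_coe_eq_traceDual μ hI hI hT0 hT hT).symm

/-! ## §4 COROLLARY 4.4: `[I] = [J] ⟺ [Iᵗ] = [Jᵗ]` and `[I]_wk = [J]_wk ⟺ [Iᵗ]_wk = [Jᵗ]_wk` -/

omit [Nonempty ι] in
/-- **«Note that `I = xJ` if only if `Iᵗ = (1/x)Jᵗ`»** (`x ∈ K^×`; `↑TI = Iᵗ`, `↑TJ = Jᵗ`).
[cite: Marseglia2019, §4 Cor. 4.4 (proof), p. 8] -/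
theorem eq_spanSingleton_mul_iff_of_coe_eq_traceDual {I J TI TJ : FractionalIdeal (endOrder (Algebra.leftMulMatrix μ))⁰ K}
    (hI : I ≠ 0) (hJ : J ≠ 0) {x : K} (hx : x ≠ 0)
    (hTI : (TI : Submodule (endOrder (Algebra.leftMulMatrix μ)) K) =
      traceDual ℤ ℚ (I : Submodule (endOrder (Algebra.leftMulMatrix μ)) K))
    (hTJ : (TJ : Submodule (endOrder (Algebra.leftMulMatrix μ)) K) =
      traceDual ℤ ℚ (J : Submodule (endOrder (Algebra.leftMulMatrix μ)) K)) :
    I = spanSingleton (endOrder (Algebra.leftMulMatrix μ))⁰ x * J ↔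
      TI = spanSingleton (endOrder (Algebra.leftMulMatrix μ))⁰ x⁻¹ * TJ := by
  constructor
  · intro h
    apply coeToSubmodule_inj.1
    rw [hTI, h, coe_spanSingleton_inv_mul_eq_traceDual μ hx hTJ]
  · intro h
    have hI' : (I : Submodule (endOrder (Algebra.leftMulMatrix μ)) K) =
        traceDual ℤ ℚ (TI : Submodule (endOrder (Algebra.leftMulMatrix μ)) K) := by
      rw [hTI, traceDual_traceDual_coe μ hI]
    have hJ' : (J : Submodule (endOrder (Algebra.leftMulMatrix μ)) K) =
        traceDual ℤ ℚ (TJ : Submodule (endOrder (Algebra.leftMulMatrix μ)) K) := by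
      rw [hTJ, traceDual_traceDual_coe μ hJ]
    apply coeToSubmodule_inj.1
    rw [hI', h, ← coe_spanSingleton_inv_mul_eq_traceDual μ (inv_ne_zero hx) hJ', inv_inv]

omit [Nonempty ι] in
/-- **COROLLARY 4.4, first equivalence: `[I] = [J] ⟺ [Iᵗ] = [Jᵗ]` in `ICM(R)`** (the classes `I ≃ J ⟺ I = xJ`,
COR. 3.4). [cite: Marseglia2019, §4 Cor. 4.4, p. 8] -/
theorem exists_eq_spanSingleton_mul_iff_of_coe_eq_traceDual {I J TI TJ : FractionalIdeal (endOrder (Algebra.leftMulMatrix μ))⁰ K}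
    (hI : I ≠ 0) (hJ : J ≠ 0)
    (hTI : (TI : Submodule (endOrder (Algebra.leftMulMatrix μ)) K) =
      traceDual ℤ ℚ (I : Submodule (endOrder (Algebra.leftMulMatrix μ)) K))
    (hTJ : (TJ : Submodule (endOrder (Algebra.leftMulMatrix μ)) K) =
      traceDual ℤ ℚ (J : Submodule (endOrder (Algebra.leftMulMatrix μ)) K)) :
    (∃ x : K, x ≠ 0 ∧ I = spanSingleton (endOrder (Algebra.leftMulMatrix μ))⁰ x * J) ↔
      ∃ y : K, y ≠ 0 ∧ TI = spanSingleton (endOrder (Algebra.leftMulMatrix μ))⁰ y * TJ :=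
  ⟨fun ⟨x, hx, h⟩ => ⟨x⁻¹, inv_ne_zero hx, (eq_spanSingleton_mul_iff_of_coe_eq_traceDual μ hI hJ hx hTI hTJ).1 h⟩,
    fun ⟨y, hy, h⟩ => ⟨y⁻¹, inv_ne_zero hy,
      (eq_spanSingleton_mul_iff_of_coe_eq_traceDual μ hI hJ (inv_ne_zero hy) hTI hTJ).2 (by rwa [inv_inv])⟩⟩

omit [Nonempty ι] in
/-- **«the equality `(I:J)(J:I) = (Jᵗ:Iᵗ)(Iᵗ:Jᵗ)`»** (LEMMA 2.3 twice). [cite: Marseglia2019, §4 Cor. 4.4 (proof), p. 8] -/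
theorem div_mul_div_eq_of_coe_eq_traceDual {I J TI TJ : FractionalIdeal (endOrder (Algebra.leftMulMatrix μ))⁰ K}
    (hI : I ≠ 0) (hJ : J ≠ 0) (hTI0 : TI ≠ 0) (hTJ0 : TJ ≠ 0)
    (hTI : (TI : Submodule (endOrder (Algebra.leftMulMatrix μ)) K) =
      traceDual ℤ ℚ (I : Submodule (endOrder (Algebra.leftMulMatrix μ)) K))
    (hTJ : (TJ : Submodule (endOrder (Algebra.leftMulMatrix μ)) K) =
      traceDual ℤ ℚ (J : Submodule (endOrder (Algebra.leftMulMatrix μ)) K)) :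
    I / J * (J / I) = TJ / TI * (TI / TJ) := by
  rw [div_eq_div_of_coe_eq_traceDual μ hI hJ hTI0 hTI hTJ, div_eq_div_of_coe_eq_traceDual μ hJ hI hTJ0 hTJ hTI]

omit [Nonempty ι] in
/-- **COROLLARY 4.4, second equivalence: `I` and `J` are weakly equivalent iff `Iᵗ` and `Jᵗ` are**
(`1 ∈ (I:J)(J:I) ⟺ 1 ∈ (Iᵗ:Jᵗ)(Jᵗ:Iᵗ)`). [cite: Marseglia2019, §4 Cor. 4.4, p. 8] -/
theorem one_mem_div_mul_div_iff_of_coe_eq_traceDual {I J TI TJ : FractionalIdeal (endOrder (Algebra.leftMulMatrix μ))⁰ K}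
    (hI : I ≠ 0) (hJ : J ≠ 0) (hTI0 : TI ≠ 0) (hTJ0 : TJ ≠ 0)
    (hTI : (TI : Submodule (endOrder (Algebra.leftMulMatrix μ)) K) =
      traceDual ℤ ℚ (I : Submodule (endOrder (Algebra.leftMulMatrix μ)) K))
    (hTJ : (TJ : Submodule (endOrder (Algebra.leftMulMatrix μ)) K) =
      traceDual ℤ ℚ (J : Submodule (endOrder (Algebra.leftMulMatrix μ)) K)) :
    (1 : K) ∈ I / J * (J / I) ↔ (1 : K) ∈ TI / TJ * (TJ / TI) := by
  rw [div_mul_div_eq_of_coe_eq_traceDual μ hI hJ hTI0 hTJ0 hTI hTJ, mul_comm]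

/-! ## §5 Duals of products by invertible ideals: `(LI)ᵗ = L⁻¹Iᵗ`, `Lᵗ = L⁻¹𝔬ᵗ` -/

/-- **`(LI)ᵗ = L′·Iᵗ` for `L` invertible with inverse `L′` (`LL′ = 𝔬`)** — the invertible-ideal form of LEMMA 2.3's
`(xI)ᵗ = x⁻¹Iᵗ` («if this is true, then `b = A : a`»: quotients by invertible ideals are products).
[cite: Marseglia2019, §2 Lemma 2.3, p. 4] [cite: BuchmannLenstra1994, §2.3, p. 228] -/
theorem coe_mul_eq_traceDual_mul_of_mul_eq_one {I T L L' : FractionalIdeal (endOrder (Algebra.leftMulMatrix μ))⁰ K}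
    (hLL' : L * L' = 1)
    (hT : (T : Submodule (endOrder (Algebra.leftMulMatrix μ)) K) =
      traceDual ℤ ℚ (I : Submodule (endOrder (Algebra.leftMulMatrix μ)) K)) :
    ((L' * T : FractionalIdeal (endOrder (Algebra.leftMulMatrix μ))⁰ K) : Submodule (endOrder (Algebra.leftMulMatrix μ)) K) =
      traceDual ℤ ℚ ((L * I : FractionalIdeal (endOrder (Algebra.leftMulMatrix μ))⁰ K) :
        Submodule (endOrder (Algebra.leftMulMatrix μ)) K) := by
  have hL0 : L ≠ 0 := fun h => one_ne_zero' (FractionalIdeal (endOrder (Algebra.leftMulMatrix μ))⁰ K)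
    (by rw [← hLL', h, zero_mul])
  have hTL : T / L = L' * T := by
    rw [mul_comm L']
    exact EndOrder.div_eq_mul_of_mul_eq (one_mul 1) (one_ne_zero' _) (one_mul T) hLL'
  ext y
  rw [coe_mul L I, mul_comm (L : Submodule (endOrder (Algebra.leftMulMatrix μ)) K), mem_traceDual_mul_iff, ← hT, mem_coe,
    ← hTL, mem_div_iff_of_ne_zero hL0]
  simp only [mem_coe]

/-- **The trace dual of an invertible ideal: `Lᵗ = L′·𝔬ᵗ`** (`LL′ = 𝔬`, `↑T𝔬 = 𝔬ᵗ`) — in particular `Lᵗ` is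
invertible when `𝔬ᵗ` is. [cite: Marseglia2019, §2 Lemma 2.3, p. 4] [cite: BuchmannLenstra1994, §2.3 («`b = A : a` is then
invertible as well»), pp. 228, 230] -/
theorem coe_mul_eq_traceDual_of_mul_eq_one {T L L' : FractionalIdeal (endOrder (Algebra.leftMulMatrix μ))⁰ K}
    (hLL' : L * L' = 1)
    (hT : (T : Submodule (endOrder (Algebra.leftMulMatrix μ)) K) =
      traceDual ℤ ℚ ((1 : FractionalIdeal (endOrder (Algebra.leftMulMatrix μ))⁰ K) :
        Submodule (endOrder (Algebra.leftMulMatrix μ)) K)) :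
    ((L' * T : FractionalIdeal (endOrder (Algebra.leftMulMatrix μ))⁰ K) : Submodule (endOrder (Algebra.leftMulMatrix μ)) K) =
      traceDual ℤ ℚ (L : Submodule (endOrder (Algebra.leftMulMatrix μ)) K) := by
  rw [coe_mul_eq_traceDual_mul_of_mul_eq_one μ hLL' hT, mul_one]

end TraceDualClasses

end CMTypeLattice

end Literature.NumberTheory.ComplexMultiplication
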